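import Mathlib
import HarnessLib
import Literature.Combinatorics.Additive.StepBeyondKempermanTwoHoles
import Literature.Combinatorics.Additive.StepBeyondKempermanTwoHolesCount
import Literature.Combinatorics.Additive.StepBeyondKempermanTwoHolesSmall

/-!
# Grynkiewicz 2009, §6 Claim 5 reduced to its last case `l = 4`

[cite: Grynkiewicz2009, §6 Claim 5 (proof of Thm 4.1, pp. 24–25)] [tag: critical-pair] [tag: inverse-theorem]

Topic `Literature/Combinatorics/Additive`.  Cell `mm-stpp` (D-0046), seat `mm-stpp-lit` (gen 23); the
port of D. J. Grynkiewicz, *A step beyond Kemperman's structure theorem*, Mathematika **55** (2009)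
67–114 continued.  This file ASSEMBLES the kernel-checked part of §6 Claim 5 («`d⊆(A + B, 𝒫) ≥ 3`»;
print pp. 24–25 up to «So we can assume `l = 4`») — `claim5_setup` (first paragraph, (40)),
`seventeen_of_relevant_subset_coset` (+`_right`) (second paragraph, (41)),
`exists_two_disjoint_relevant` / `card_carrier_eq_two_of_relevant` / `sub_mem_or_sub_mem_of_relevant` /
`not_sub_mem_of_two_holes` (third paragraph), `seventeen_of_le_three_pairs` (cases `l = 2, 3`) — into
ONE reduction: under the core-case assumptions of §6, a periodic `P ⊇ A + B` with `|P ∖ (A + B)| ≤ 2`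
yields (17) OR the complete data of the remaining printed case `l = 4` (print pp. 25–26: `|H| = 2`,
`H = H(P)` the maximal period, `P = (A + B) ∪ {γ₁, γ₂} = A + B + H`, `ρ = |H| + 2`, (40), two relevant
pairs `(x, y), (x′, y′)` on distinct cosets with ALL FOUR coset pairs `{x, x′} × {y, y′}` relevant, every
relevant `a ≡ x, x′` and `b ≡ y, y′`, the one-hole structure `|A_x| + |B_y| = |A_{x′}| + |B_{y′}| = 2`
with no other holes, and `γ₁ ≢ γ₂ (mod H)`), from which the print derives a type-(VIII) decomposition
via the Klein group `K = H × H′` and KST for `(φ_H(A), φ_H(B))`.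

MAIN RESULT (0 definitions, 0 named facts; everything PROVED).
* `Grynkiewicz2009.seventeen_or_fourPairs` — **CLAIM 5 ⇐ THE CASE `l = 4`.**

## References
* D. J. Grynkiewicz, *A step beyond Kemperman's structure theorem*, Mathematika 55 (2009) 67–114,
  doi:10.1112/S0025579300000966, §6 Claim 5 (pp. 24–26) [cite: Grynkiewicz2009, Thm 4.1 (proof,
  Claim 5)] — held `paper:doi-10-1112-s0025579300000966`, p0024–p0026 read 2026-08-29.
-/

namespace Literature.Combinatorics.Additive

open Finset
open scoped Pointwise

universe u

variable {G : Type u} [AddCommGroup G] [DecidableEq G]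

namespace Grynkiewicz2009

omit [DecidableEq G] in
/-- Membership transfer along an identity. [folklore] -/
private theorem memH' {H : AddSubgroup G} {s t : G} (hs : s ∈ H) (e : t = s) : t ∈ H := by
  rw [e]; exact hs

/-- **Claim 5 reduced to `l = 4`.**  For finite `G` and `A, B` satisfying the core-case assumptions
of §6 (`0 ∈ A ∩ B`, `|A + B| = |A| + |B|`, `A + B` aperiodic, `d⊆(A + B, 𝒫) ≥ 2` (Claim 2), `(A, B)`
non-extendible, `A`, `B` not quasi-periodic (Claim 4), `⟨A⟩ = ⟨B⟩ = G`): if some periodic `P ⊇ A + B`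
has `|P ∖ (A + B)| ≤ 2`, then (17) holds, or else we are in the case `l = 4` of the print with all its
standing data (listed in the module docstring), for the maximal period `H = H(P)`, `|H| = 2`.
[cite: Grynkiewicz2009, §6 Claim 5 (pp. 24–25)] -/
theorem seventeen_or_fourPairs [Fintype G] {A B P : Finset G}
    (h0A : (0 : G) ∈ A) (h0B : (0 : G) ∈ B) (hAB : #(A + B) = #A + #B)
    (haper : (A + B).addStab = {0})
    (hP2 : ∀ Q : Finset G, A + B ⊆ Q → Q.addStab ≠ {0} → 2 ≤ #(Q \ (A + B)))
    (hneA : IsNonExtendible A B) (hneB : IsNonExtendible B A)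
    (hAqp : ¬ IsQuasiPeriodic A) (hBqp : ¬ IsQuasiPeriodic B)
    (hgenA : AddSubgroup.closure (A : Set G) = ⊤) (hgenB : AddSubgroup.closure (B : Set G) = ⊤)
    (hP : A + B ⊆ P) (hPper : P.addStab ≠ {0}) (hPle : #(P \ (A + B)) ≤ 2) :
    (∃ α β : G, #(insert α A + insert β B) + 1 = #(insert α A) + #(insert β B)) ∨
    ∃ (H : AddSubgroup G) (Hf : Finset G) (γ₁ γ₂ x y x' y' : G),
      (∀ g, g ∈ Hf ↔ g ∈ H) ∧ #Hf = 2 ∧ (insert γ₁ (insert γ₂ (A + B))).addStab = Hf ∧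
      γ₁ ∉ A + B ∧ γ₂ ∉ A + B ∧ γ₁ ≠ γ₂ ∧ γ₁ - γ₂ ∉ H ∧
      insert γ₁ (insert γ₂ (A + B)) = A + B + Hf ∧
      #(A + Hf) + #(B + Hf) = #A + #B + #Hf + 2 ∧
      cosetCount H (A + B) + 1 = cosetCount H A + cosetCount H B ∧
      x ∈ A ∧ y ∈ B ∧ x' ∈ A ∧ y' ∈ B ∧ x - x' ∉ H ∧ y - y' ∉ H ∧
      (x + y - γ₁ ∈ H ∨ x + y - γ₂ ∈ H) ∧ (x' + y' - γ₁ ∈ H ∨ x' + y' - γ₂ ∈ H) ∧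
      (x + y' - γ₁ ∈ H ∨ x + y' - γ₂ ∈ H) ∧ (x' + y - γ₁ ∈ H ∨ x' + y - γ₂ ∈ H) ∧
      (∀ u ∈ A, ∀ v ∈ B, (u + v - γ₁ ∈ H ∨ u + v - γ₂ ∈ H) → u - x ∈ H ∨ u - x' ∈ H) ∧
      (∀ u ∈ A, ∀ v ∈ B, (u + v - γ₁ ∈ H ∨ u + v - γ₂ ∈ H) → v - y ∈ H ∨ v - y' ∈ H) ∧
      #(A ∩ (x +ᵥ Hf)) + #(B ∩ (y +ᵥ Hf)) = 2 ∧ #(A ∩ (x' +ᵥ Hf)) + #(B ∩ (y' +ᵥ Hf)) = 2 ∧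
      (A + Hf) \ ((x +ᵥ Hf) ∪ (x' +ᵥ Hf)) ⊆ A ∧ (B + Hf) \ ((y +ᵥ Hf) ∪ (y' +ᵥ Hf)) ⊆ B := by
  classical
  have hA : A.Nonempty := ⟨0, h0A⟩
  have hB : B.Nonempty := ⟨0, h0B⟩
  have hCne : (A + B).Nonempty := hA.add hB
  -- `P = (A + B) ∪ {γ₁, γ₂}`
  have hcard2 : #(P \ (A + B)) = 2 := le_antisymm hPle (hP2 P hP hPper)
  obtain ⟨γ₁, γ₂, hne, hPeq⟩ := card_eq_two.1 hcard2
  have hγ₁P : γ₁ ∈ P \ (A + B) := by rw [hPeq]; simp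
  have hγ₂P : γ₂ ∈ P \ (A + B) := by rw [hPeq]; simp
  have hγ₁ : γ₁ ∉ A + B := (mem_sdiff.1 hγ₁P).2
  have hγ₂ : γ₂ ∉ A + B := (mem_sdiff.1 hγ₂P).2
  have hPC : P = insert γ₁ (insert γ₂ (A + B)) := by
    rw [← union_sdiff_of_subset hP, hPeq]
    ext z; simp only [mem_union, mem_insert, mem_singleton]; tauto
  -- the maximal period `H = H(P)`
  have hPne : P.Nonempty := ⟨γ₁, (mem_sdiff.1 hγ₁P).1⟩
  set H : AddSubgroup G := AddAction.stabilizer G P with hHdef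
  have hHf : ∀ g, g ∈ P.addStab ↔ g ∈ H := fun g => by
    rw [mem_addStab hPne, hHdef, AddAction.mem_stabilizer_iff]
  have hH : H ≠ ⊥ := by
    intro hbot
    apply hPper
    refine eq_singleton_iff_unique_mem.2 ⟨(hHf 0).2 H.zero_mem, fun g hg => ?_⟩
    have := (hHf g).1 hg
    rw [hbot] at this
    exact (AddSubgroup.mem_bot).1 this
  have hstab : (insert γ₁ (insert γ₂ (A + B))).addStab = P.addStab := by rw [← hPC]
  -- first paragraph
  obtain ⟨hC', hρ, h40, -, -, -⟩ :=
    claim5_setup hHf hH hA hB hAB haper hAqp hBqp hγ₁ hγ₂ hne hstab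
  -- coverage: both new elements are hit by a relevant pair
  have hcov : ∀ γ : G, γ ∈ insert γ₁ (insert γ₂ (A + B)) → ∃ u ∈ A, ∃ v ∈ B, u + v - γ ∈ H := by
    intro γ hγ
    rw [hC'] at hγ
    obtain ⟨c, hc, h, hh, rfl⟩ := mem_add.1 hγ
    obtain ⟨u, hu, v, hv, rfl⟩ := mem_add.1 hc
    refine ⟨u, hu, v, hv, memH' (H.neg_mem ((hHf h).1 hh)) (by abel)⟩
  have hcov₁ := hcov γ₁ (mem_insert_self _ _)
  have hcov₂ := hcov γ₂ (mem_insert_of_mem (mem_insert_self _ _))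
  -- second paragraph: w.l.o.g. two relevant cosets on each side
  by_cases h1 : ∃ a₁ : G, ∀ a ∈ A, ∀ b ∈ B, (a + b - γ₁ ∈ H ∨ a + b - γ₂ ∈ H) → a - a₁ ∈ H
  · obtain ⟨a₁, ha₁⟩ := h1
    exact Or.inl (seventeen_of_relevant_subset_coset hHf hH hC' hneA hAqp h0A hgenA hAB hγ₁ hγ₂ hne
      ha₁)
  by_cases h2 : ∃ b₁ : G, ∀ a ∈ A, ∀ b ∈ B, (a + b - γ₁ ∈ H ∨ a + b - γ₂ ∈ H) → b - b₁ ∈ H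
  · obtain ⟨b₁, hb₁⟩ := h2
    exact Or.inl (seventeen_of_relevant_subset_coset_right hHf hH hC' hneB hBqp h0B hgenB hAB hγ₁
      hγ₂ hne hb₁)
  push Not at h1 h2
  obtain ⟨a₀, ha₀, b₀, hb₀, hab₀⟩ := hcov₁
  obtain ⟨a', ha', b', hb', hrel', ha'a₀⟩ := h1 a₀
  obtain ⟨c', hc', d', hd', hrel'', hd'b₀⟩ := h2 b₀
  -- third paragraph
  obtain ⟨x, y, x', y', ⟨hx, hy, hxy⟩, ⟨hx', hy', hx'y'⟩, hxx', hyy'⟩ :=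
    exists_two_disjoint_relevant (H := H)
      (R := fun a b => a ∈ A ∧ b ∈ B ∧ (a + b - γ₁ ∈ H ∨ a + b - γ₂ ∈ H))
      ⟨ha', hb', hrel'⟩ ⟨ha₀, hb₀, Or.inl hab₀⟩ ha'a₀ ⟨hc', hd', hrel''⟩ ⟨ha₀, hb₀, Or.inl hab₀⟩ hd'b₀
  obtain ⟨hHf2, ht, ht', hfullA, hfullB⟩ :=
    card_carrier_eq_two_of_relevant hHf hH hγ₁ hγ₂ hρ hx hy hxy hx' hy' hx'y' hxx' hyy'
  have hγ₁' : γ₁ ∉ B + A := by rwa [add_comm]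
  have hγ₂' : γ₂ ∉ B + A := by rwa [add_comm]
  have hrelA : ∀ u ∈ A, ∀ v ∈ B, (u + v - γ₁ ∈ H ∨ u + v - γ₂ ∈ H) → u - x ∈ H ∨ u - x' ∈ H := by
    intro u hu v hv h
    rcases h with h | h
    · exact sub_mem_or_sub_mem_of_relevant hHf hHf2 hγ₁ hfullA hu hv h
    · exact sub_mem_or_sub_mem_of_relevant hHf hHf2 hγ₂ hfullA hu hv h
  have hrelB : ∀ u ∈ A, ∀ v ∈ B, (u + v - γ₁ ∈ H ∨ u + v - γ₂ ∈ H) → v - y ∈ H ∨ v - y' ∈ H := by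
    intro u hu v hv h
    rcases h with h | h
    · exact sub_mem_or_sub_mem_of_relevant hHf hHf2 hγ₁' hfullB hv hu (by rwa [add_comm v u])
    · exact sub_mem_or_sub_mem_of_relevant hHf hHf2 hγ₂' hfullB hv hu (by rwa [add_comm v u])
  have hγ₁₂ : γ₁ - γ₂ ∉ H := not_sub_mem_of_two_holes hHf hH hHf2 hC' hCne haper hγ₁ hγ₂ hne
  -- the cases `l ≤ 3`
  by_cases h4 : (x + y' - γ₁ ∈ H ∨ x + y' - γ₂ ∈ H) ∧ (x' + y - γ₁ ∈ H ∨ x' + y - γ₂ ∈ H)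
  swap
  · have hl : (x + y' - γ₁ ∉ H ∧ x + y' - γ₂ ∉ H) ∨ (x' + y - γ₁ ∉ H ∧ x' + y - γ₂ ∉ H) := by
      by_contra hno
      push Not at hno
      apply h4
      constructor
      · by_contra h; push Not at h; exact (hno.1 h.1 |> h.2)
      · by_contra h; push Not at h; exact (hno.2 h.1 |> h.2)
    exact Or.inl (seventeen_of_le_three_pairs hHf hC' hγ₁ hγ₂ hγ₁₂ hAB hx hy hx' hy' hxx' hyy' hxy
      hx'y' hrelA hrelB (hcov γ₁ (mem_insert_self _ _)) hcov₂ hl)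
  -- `l = 4`
  right
  refine ⟨H, P.addStab, γ₁, γ₂, x, y, x', y', hHf, hHf2, hstab, hγ₁, hγ₂, hne, hγ₁₂, hC', hρ, h40,
    hx, hy, hx', hy', hxx', hyy', hxy, hx'y', h4.1, h4.2, hrelA, hrelB, ht, ht', hfullA, hfullB⟩

end Grynkiewicz2009

end Literature.Combinatorics.Additive
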